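import Summits.ResolutionOfSingularities.ResolutionOfSingularities.Theses.PAlteration
import Literature.AlgebraicGeometry.Resolution.AlterationsResolution
import Literature.AlgebraicGeometry.Resolution.AlterationsProofs

/-!
# `Pialt` — negative lemmas I: the sandwich, load-bearing hypotheses and conclusions

Support (negative) lemmas for crux `stmt-ResolutionOfSingularities-0555`
(`Summit.ResolutionOfSingularities.ResolutionOfSingularities.Theses.PAlteration.Pialt`: for every
prime `p`, every integral separated finite-type `X / k` with `char k = p` has a proper surjective
`g : X' → X` from an integral regular `X'`, finite and universally injective over a dense open of
`X` — a purely inseparable regular alteration; Abramovich–Oort 2000 Q. 2.13 = Temkin 2013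
Conj. 1.3.1, positive-characteristic slice), filed by the standing disprover (cdisprove gen 1; work
file `Cruxes/Pialt/Disproof.lean`). This file declares NO definition: every variant statement is
written out inline, and NO declaration concludes the route decl `Pialt` positively.

* `exists_not_hasResolution_of_not_pialt` / `not_resolutionOfSingularities_of_not_pialt` — the
  summit implies the crux (a weak resolution of an integral `X` IS a purely inseparable regular
  alteration, `U` = its iso-locus: `IsResolution.isPurelyInseparableAlteration` in the tree), so
  any witness against the crux is an integral separated finite-type variety over a field of
  characteristic `p` WITHOUT a weak resolution, and `¬ Pialt → ¬ ResolutionOfSingularities`.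
  With `not_abramovichOortConjecture_of_not_pialt` / `not_pialt_of_not_abramovichOortConjecture`
  (the latter modulo `Hironaka1964`): the crux is exactly the char-`p` slice of the named open
  conjecture `AbramovichOortConjecture`.
* `pialt_false_without_isIntegral` — with `IsIntegral X` weakened to the summit's `IsReduced X`
  the statement is FALSE: the empty scheme over `𝔽₂` (an integral `X'` cannot map onto `∅`);
  `pialt_false_without_irreducible` — weakened to `IsReduced X ∧ Nonempty X` it is still FALSE:
  the two-point scheme `Spec (𝔽₂ × 𝔽₂)` (the image of the irreducible `X'` under the surjective
  `g` would be irreducible, but `D(1,0) ∋ 0 × 𝔽₂` and `D(0,1) ∋ 𝔽₂ × 0` are disjoint), so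
  irreducibility itself is load-bearing.
  (`LocallyOfFiniteType` is load-bearing too: companion file `FiniteTypeLoadBearing.lean`.)
* `pialt_without_universallyInjective_of_deJong1996` — with `UniversallyInjective (g ∣_ U)`
  dropped from the conclusion the statement is de Jong's alteration theorem (named fact
  `DeJong1996`, Thm. 4.1, weak form): radiciality is the entire open content of the crux.
* `pialt_without_dense_of_deJong1996` — with `Dense U` dropped, `U = ∅` is admissible (empty
  source: finiteness and radiciality are vacuous) and the rest again follows from `DeJong1996`.
* `pialt_without_isRegular_trivial` — with `Scheme.IsRegular X'` dropped the statement is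
  trivial (identity).
* `pialt_without_surjective_trivial` — with `Function.Surjective g.base` dropped the statement is
  trivial: a closed point `Spec κ(x) ↪ X` with `U = X ∖ {x}` (empty source over `U`), or the
  identity when `X` is a single point (zero-dimensional integral, hence regular).
* `pialt_birational_iff_resolutionOfSingularities` — the natural strengthening "`g` an isomorphism
  over the dense open `U`" (instead of finite + universally injective) is EQUIVALENT to the summit
  `ResolutionOfSingularities` (via the in-tree reduced → integral descent
  `DescentReducedToIntegral_holds`): the distance from the crux to the summit is exactly
  "radicial ↦ isomorphism over `U`". (The other natural strengthening, "finite + radicial over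
  ALL of `X`", is false: companion file `FiniteStrengtheningFalse.lean`.)

## Sources
* M. Temkin, *Inseparable local uniformization*, J. Algebra 373 (2013) 65–119
  (arXiv:0804.1554v3): Conj. 1.3.1, §1 (i) ⊂ (iii).
* D. Abramovich, F. Oort, *Alterations and resolution of singularities*, Progr. Math. 181 (2000),
  Question 2.13 (arXiv:math/9806100).
* A. J. de Jong, *Smoothness, semi-stability and alterations*, Publ. IHÉS 83 (1996), Thm. 4.1.
* The Stacks Project, Tags 01RN (birational), 02IS (regular schemes).
-/

noncomputable section

-- single-problem summit: the doubled namespace component `ResolutionOfSingularities` is forced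
set_option linter.dupNamespace false

open CategoryTheory AlgebraicGeometry TopologicalSpace Topology Polynomial
open Literature.AlgebraicGeometry.Resolution

namespace Summit.ResolutionOfSingularities.ResolutionOfSingularities.Theorems.Pialt.Negative

open Summit.ResolutionOfSingularities.ResolutionOfSingularities.Theses.PAlteration (Pialt)

/-! ## The summit implies the crux: what a counterexample must be -/

/-- **Any counterexample to the crux is an integral separated finite-type variety over a field of
characteristic `p` WITHOUT a weak resolution**: a resolution `π : X̃ → X` of an integral `X` is a
purely inseparable regular alteration (`X̃` integral, `π` proper and surjective, an isomorphism —
so finite and universally injective — over the dense open `U` of `IsBirational`). [cite: Temkin2013, §1 p. 3 (i), (iii)] -/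
theorem exists_not_hasResolution_of_not_pialt (h : ¬ Pialt) :
    ∃ p : ℕ, p.Prime ∧ ∃ (k : Type) (_ : Field k) (_ : CharP k p) (X : Scheme.{0})
      (f : X ⟶ Spec (.of k)), IsSeparated f ∧ LocallyOfFiniteType f ∧ QuasiCompact f ∧
        IsIntegral X ∧ ¬ Scheme.HasResolution X := by
  by_contra hcon
  apply h
  intro p hp k _ _ X f hs hl hq hi
  by_contra hX
  refine hcon ⟨p, hp, k, inferInstance, inferInstance, X, f, hs, hl, hq, hi, fun hres => hX ?_⟩
  obtain ⟨Y, φ, hφ, hreg⟩ := hres.exists_isPurelyInseparableAlteration_and_isRegular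
  exact ⟨Y, φ, hφ.isProper, hφ.isIntegral, hreg, hφ.surjective.1, hφ.exists_dense⟩

/-- **A disproof of the crux is a disproof of resolution of singularities in positive
characteristic**: `¬ Pialt → ¬ ResolutionOfSingularities`. [folklore] -/
theorem not_resolutionOfSingularities_of_not_pialt (h : ¬ Pialt) :
    ¬ _root_.ResolutionOfSingularities := by
  obtain ⟨p, hp, k, _, _, X, f, hs, hl, hq, hi, hX⟩ := exists_not_hasResolution_of_not_pialt h
  exact fun hres => hX (hres p hp k X f hs hl hq inferInstance)

/-- A disproof of the crux disproves the named open conjecture `AbramovichOortConjecture` (all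
characteristics). [cite: Temkin2013, Conj. 1.3.1] -/
theorem not_abramovichOortConjecture_of_not_pialt (h : ¬ Pialt) :
    ¬ AbramovichOortConjecture.{0} := by
  intro hAO
  apply h
  intro p hp k _ _ X f hs hl hq hi
  obtain ⟨Y, φ, hφ, hreg⟩ := hAO k X f hs hl hq hi
  exact ⟨Y, φ, hφ.isProper, hφ.isIntegral, hreg, hφ.surjective.1, hφ.exists_dense⟩

/-- Conversely, modulo `Hironaka1964` (characteristic `0`), a disproof of `AbramovichOortConjecture`
disproves the crux: the crux is the conjecture's positive-characteristic slice.
[cite: Temkin2013, Conj. 1.3.1 and §1 (i)] -/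
theorem not_pialt_of_not_abramovichOortConjecture (h0 : Hironaka1964.{0})
    (h : ¬ AbramovichOortConjecture.{0}) : ¬ Pialt := by
  intro hP
  apply h
  intro k _ X f hs hl hq hi
  obtain ⟨p, hchar⟩ := CharP.exists k
  rcases CharP.char_is_prime_or_zero k p with hp | rfl
  · obtain ⟨X', g, hprop, hint, hreg, hsurj, U, hU, hfin, hui⟩ := hP p hp k X f hs hl hq hi
    haveI : Surjective g := ⟨hsurj⟩
    exact ⟨X', g, ⟨hint, hprop, inferInstance, U, hU.nonempty, hfin, hui⟩, hreg⟩
  · haveI : CharZero k := CharP.charP_to_charZero k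
    haveI := hs; haveI := hl; haveI := hq
    exact abramovichOort_of_hironaka1964 h0 k X f

/-! ## Load-bearing hypotheses -/

/-- **`IsIntegral X` is load-bearing**: with only the summit's `IsReduced X` the statement fails
at the empty scheme over `𝔽₂` — an integral `X'` is non-empty and cannot map to `∅`. [folklore] -/
theorem pialt_false_without_isIntegral :
    ¬ ∀ p : ℕ, p.Prime → ∀ (k : Type) [Field k] [CharP k p] (X : Scheme.{0})
      (f : X ⟶ Spec (.of k)), IsSeparated f → LocallyOfFiniteType f → QuasiCompact f →
        IsReduced X → ∃ (X' : Scheme.{0}) (g : X' ⟶ X), IsProper g ∧ IsIntegral X' ∧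
          Scheme.IsRegular X' ∧ Function.Surjective g.base ∧
            ∃ U : X.Opens, Dense (U : Set X) ∧ IsFinite (g ∣_ U) ∧
              UniversallyInjective (g ∣_ U) := by
  intro h
  haveI : IsReduced (∅ : Scheme.{0}) := ⟨fun U => ⟨fun x _ => Subsingleton.elim x 0⟩⟩
  obtain ⟨X', g, -, hint, -⟩ := h 2 Nat.prime_two (ZMod 2) (∅ : Scheme.{0})
    (Scheme.emptyTo _) inferInstance inferInstance inferInstance inferInstance
  obtain ⟨x⟩ := hint.nonempty
  exact IsEmpty.false (g.base x)

/-- **Irreducibility of `X` is load-bearing, not just non-emptiness**: with `IsIntegral X`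
weakened to `IsReduced X ∧ Nonempty X` the crux fails at the two-point scheme
`Spec (𝔽₂ × 𝔽₂) → Spec 𝔽₂` (affine, reduced, of finite type): the image of the irreducible `X'`
under the surjective `g` would make `Spec (𝔽₂ × 𝔽₂)` irreducible, but `D(1,0)` and `D(0,1)`
are disjoint non-empty opens. [folklore] -/
theorem pialt_false_without_irreducible :
    ¬ ∀ p : ℕ, p.Prime → ∀ (k : Type) [Field k] [CharP k p] (X : Scheme.{0})
      (f : X ⟶ Spec (.of k)), IsSeparated f → LocallyOfFiniteType f → QuasiCompact f →
        IsReduced X → Nonempty X → ∃ (X' : Scheme.{0}) (g : X' ⟶ X), IsProper g ∧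
          IsIntegral X' ∧ Scheme.IsRegular X' ∧ Function.Surjective g.base ∧
            ∃ U : X.Opens, Dense (U : Set X) ∧ IsFinite (g ∣_ U) ∧
              UniversallyInjective (g ∣_ U) := by
  intro h
  let R := ZMod 2 × ZMod 2
  let f : Spec (.of R) ⟶ Spec (.of (ZMod 2)) :=
    Spec.map (CommRingCat.ofHom (algebraMap (ZMod 2) R))
  haveI : LocallyOfFiniteType f :=
    (HasRingHomProperty.Spec_iff (P := @LocallyOfFiniteType)).mpr
      (RingHom.finiteType_algebraMap.mpr inferInstance)
  haveI : Nonempty ↥(Spec (.of R)) := ⟨(⟨Ideal.prod ⊥ ⊤, Ideal.isPrime_ideal_prod_top⟩ :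
    PrimeSpectrum R)⟩
  obtain ⟨X', g, -, hint, -, hsurj, -⟩ :=
    h 2 Nat.prime_two (ZMod 2) (Spec (.of R)) f inferInstance inferInstance inferInstance
      inferInstance inferInstance
  -- the image of the irreducible `X'` is everything, so `Spec R` would be (pre)irreducible
  have hirr : IsPreirreducible (Set.univ : Set (PrimeSpectrum R)) := by
    have h1 := (IrreducibleSpace.isIrreducible_univ ↥X').isPreirreducible.image g.base
      g.base.hom.continuous.continuousOn
    rw [Set.image_univ, Set.range_eq_univ.mpr hsurj] at h1
    exact h1
  -- but `D(1,0) ∋ (0 × 𝔽₂)` and `D(0,1) ∋ (𝔽₂ × 0)` are disjoint non-empty opens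
  let e₁ : R := (1, 0)
  let e₂ : R := (0, 1)
  let x₁ : PrimeSpectrum R := ⟨Ideal.prod ⊥ ⊤, Ideal.isPrime_ideal_prod_top⟩
  let x₂ : PrimeSpectrum R := ⟨Ideal.prod ⊤ ⊥, Ideal.isPrime_ideal_prod_top'⟩
  have hx₁ : x₁ ∈ (PrimeSpectrum.basicOpen e₁ : Set (PrimeSpectrum R)) :=
    (PrimeSpectrum.mem_basicOpen _ _).mpr fun hmem =>
      one_ne_zero (Ideal.mem_bot.mp ((Ideal.mem_prod _ _).mp hmem).1)
  have hx₂ : x₂ ∈ (PrimeSpectrum.basicOpen e₂ : Set (PrimeSpectrum R)) :=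
    (PrimeSpectrum.mem_basicOpen _ _).mpr fun hmem =>
      one_ne_zero (Ideal.mem_bot.mp ((Ideal.mem_prod _ _).mp hmem).2)
  obtain ⟨x, -, hx1, hx2⟩ := hirr _ _ (PrimeSpectrum.basicOpen e₁).isOpen
    (PrimeSpectrum.basicOpen e₂).isOpen ⟨x₁, Set.mem_univ _, hx₁⟩ ⟨x₂, Set.mem_univ _, hx₂⟩
  have h12 : e₁ * e₂ ∈ x.asIdeal := by
    have : e₁ * e₂ = 0 := by simp [e₁, e₂, R]
    rw [this]; exact Ideal.zero_mem _
  rcases x.2.mem_or_mem h12 with h1 | h2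
  · exact (PrimeSpectrum.mem_basicOpen _ _).mp hx1 h1
  · exact (PrimeSpectrum.mem_basicOpen _ _).mp hx2 h2

/-! ## Load-bearing parts of the conclusion -/

/-- **Radiciality is the whole open content**: with `UniversallyInjective (g ∣_ U)` dropped the
crux is de Jong's alteration theorem (named fact `DeJong1996`, Thm. 4.1, weak form).
[cite: DeJong1996, Thm. 4.1, p. 66] -/
theorem pialt_without_universallyInjective_of_deJong1996 (h : DeJong1996.{0}) :
    ∀ p : ℕ, p.Prime → ∀ (k : Type) [Field k] [CharP k p] (X : Scheme.{0})
      (f : X ⟶ Spec (.of k)), IsSeparated f → LocallyOfFiniteType f → QuasiCompact f →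
        IsIntegral X → ∃ (X' : Scheme.{0}) (g : X' ⟶ X), IsProper g ∧ IsIntegral X' ∧
          Scheme.IsRegular X' ∧ Function.Surjective g.base ∧
            ∃ U : X.Opens, Dense (U : Set X) ∧ IsFinite (g ∣_ U) := by
  intro p hp k _ _ X f hs hl hq hi
  obtain ⟨X₁, φ, hφ, hreg⟩ := h k X f hs hl hq hi
  obtain ⟨U, hU, hfin⟩ := hφ.exists_isFinite
  exact ⟨X₁, φ, hφ.isProper, hφ.isIntegral, hreg, hφ.surjective.1, U, U.isOpen.dense hU, hfin⟩

/-- **`Dense U` only excludes the junk `U = ∅`**: with it dropped, `U = ⊥` makes the finiteness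
and radiciality conjuncts vacuous (empty source) and the rest — a proper surjection from an
integral regular scheme — follows from `DeJong1996`. [folklore] -/
theorem pialt_without_dense_of_deJong1996 (h : DeJong1996.{0}) :
    ∀ p : ℕ, p.Prime → ∀ (k : Type) [Field k] [CharP k p] (X : Scheme.{0})
      (f : X ⟶ Spec (.of k)), IsSeparated f → LocallyOfFiniteType f → QuasiCompact f →
        IsIntegral X → ∃ (X' : Scheme.{0}) (g : X' ⟶ X), IsProper g ∧ IsIntegral X' ∧
          Scheme.IsRegular X' ∧ Function.Surjective g.base ∧
            ∃ U : X.Opens, IsFinite (g ∣_ U) ∧ UniversallyInjective (g ∣_ U) := by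
  intro p hp k _ _ X f hs hl hq hi
  obtain ⟨X₁, φ, hφ, hreg⟩ := h k X f hs hl hq hi
  haveI : IsEmpty (↑(φ ⁻¹ᵁ (⊥ : X.Opens)) : Scheme.{0}) :=
    ⟨fun x => TopologicalSpace.Opens.mem_bot.mp (show φ.base x.1 ∈ (⊥ : X.Opens) from x.2)⟩
  exact ⟨X₁, φ, hφ.isProper, hφ.isIntegral, hreg, hφ.surjective.1, ⊥, inferInstance, inferInstance⟩

/-- **`Scheme.IsRegular X'` carries all the content**: with it dropped the statement is trivial
(the identity of `X`, `U = X`). [folklore] -/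
theorem pialt_without_isRegular_trivial :
    ∀ p : ℕ, p.Prime → ∀ (k : Type) [Field k] [CharP k p] (X : Scheme.{0})
      (f : X ⟶ Spec (.of k)), IsSeparated f → LocallyOfFiniteType f → QuasiCompact f →
        IsIntegral X → ∃ (X' : Scheme.{0}) (g : X' ⟶ X), IsProper g ∧ IsIntegral X' ∧
          Function.Surjective g.base ∧ ∃ U : X.Opens, Dense (U : Set X) ∧ IsFinite (g ∣_ U) ∧
            UniversallyInjective (g ∣_ U) := by
  intro p hp k _ _ X f hs hl hq hi
  exact ⟨X, 𝟙 X, inferInstance, hi, (inferInstance : Surjective (𝟙 X)).1, ⊤, by simp,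
    inferInstance, inferInstance⟩

/-- **`Function.Surjective g.base` is what excludes junk**: with it dropped the crux is
TRIVIAL. Witness: a closed point `x` of `X` (one exists: `X` is quasi-compact, T₀ and non-empty),
`X' = Spec κ(x)` (integral, zero-dimensional hence regular), `g` the closed immersion
`Spec κ(x) → X` (proper), `U = X ∖ {x}` (open; dense as soon as `X ≠ {x}`; over `U` the source is
EMPTY, so finiteness and radiciality hold vacuously); if `X = {x}` then `X` itself is a
zero-dimensional integral scheme, hence regular, and the identity does it. [folklore] -/
theorem pialt_without_surjective_trivial :
    ∀ p : ℕ, p.Prime → ∀ (k : Type) [Field k] [CharP k p] (X : Scheme.{0})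
      (f : X ⟶ Spec (.of k)), IsSeparated f → LocallyOfFiniteType f → QuasiCompact f →
        IsIntegral X → ∃ (X' : Scheme.{0}) (g : X' ⟶ X), IsProper g ∧ IsIntegral X' ∧
          Scheme.IsRegular X' ∧ ∃ U : X.Opens, Dense (U : Set X) ∧ IsFinite (g ∣_ U) ∧
            UniversallyInjective (g ∣_ U) := by
  intro p hp k _ _ X f hs hl hq hi
  haveI : CompactSpace X := QuasiCompact.compactSpace_of_compactSpace f
  obtain ⟨x, -, hx⟩ :=
    (isClosed_univ : IsClosed (Set.univ : Set X)).exists_closed_singleton Set.univ_nonempty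
  by_cases hX : ∃ y : X, y ≠ x
  · -- `X' = Spec κ(x)`, `U = X ∖ {x}`
    haveI : IsClosedImmersion (X.fromSpecResidueField x) :=
      isClosed_singleton_iff_isClosedImmersion.mp hx
    let U : X.Opens := ⟨{x}ᶜ, hx.isOpen_compl⟩
    have hU : Dense (U : Set X) := by
      obtain ⟨y, hy⟩ := hX
      exact U.isOpen.dense ⟨y, Set.mem_compl_singleton_iff.mpr hy⟩
    haveI : IsEmpty (↑((X.fromSpecResidueField x) ⁻¹ᵁ U) : Scheme.{0}) := ⟨fun s => by
      have h1 : (X.fromSpecResidueField x).base s.1 ∈ (U : Set X) := s.2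
      have h2 : (X.fromSpecResidueField x).base s.1 = x := X.fromSpecResidueField_apply x s.1
      rw [h2] at h1
      exact h1 rfl⟩
    exact ⟨_, X.fromSpecResidueField x, inferInstance, inferInstance,
      Scheme.IsRegular.of_topologicalKrullDim_le_zero
        (topologicalKrullDim_zero_of_discreteTopology _), U, hU, inferInstance, inferInstance⟩
  · -- `X = {x}` is a zero-dimensional integral scheme, hence regular
    push Not at hX
    haveI : Subsingleton X := ⟨fun a b => (hX a).trans (hX b).symm⟩
    exact ⟨X, 𝟙 X, inferInstance, hi,
      Scheme.IsRegular.of_topologicalKrullDim_le_zero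
        (topologicalKrullDim_zero_of_discreteTopology _), ⊤, by simp, inferInstance,
      inferInstance⟩

/-! ## The birational strengthening is the summit -/

/-- **The birational strengthening of the crux is exactly the summit**: "some proper surjective
`g : X' → X` from an integral regular `X'` that is an ISOMORPHISM over a dense open of `X`, for
every integral separated finite-type `X` over every field of prime characteristic" is equivalent
to `ResolutionOfSingularities` (`→`: the preimage of `U` is a non-empty open of the irreducible
`X'`, hence dense, so `g` is a weak resolution, and reduced → integral by the in-tree
`DescentReducedToIntegral_holds`; `←`: a weak resolution of an integral scheme has integral source
and is surjective). So the distance from the crux to the summit is precisely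
"finite + universally injective ↦ isomorphism over the dense open". [folklore] -/
theorem pialt_birational_iff_resolutionOfSingularities :
    (∀ p : ℕ, p.Prime → ∀ (k : Type) [Field k] [CharP k p] (X : Scheme.{0})
      (f : X ⟶ Spec (.of k)), IsSeparated f → LocallyOfFiniteType f → QuasiCompact f →
        IsIntegral X → ∃ (X' : Scheme.{0}) (g : X' ⟶ X), IsProper g ∧ IsIntegral X' ∧
          Scheme.IsRegular X' ∧ Function.Surjective g.base ∧
            ∃ U : X.Opens, Dense (U : Set X) ∧ IsIso (g ∣_ U)) ↔
    _root_.ResolutionOfSingularities := by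
  constructor
  · intro h p hp k _ _ X f hs hl hq hr
    refine Theses.PAlteration.DescentReducedToIntegral_holds k ?_ X f hs hl hq hr
    intro Y g hs' hl' hq' hi'
    obtain ⟨X', π, hprop, hint, hreg, hsurj, U, hU, hiso⟩ := h p hp k Y g hs' hl' hq' hi'
    refine ⟨X', π, hprop, ⟨U, hU, ?_, hiso⟩, hreg⟩
    obtain ⟨y, hy⟩ := hU.nonempty
    obtain ⟨x, hx⟩ := hsurj y
    refine (π ⁻¹ᵁ U).isOpen.dense ⟨x, ?_⟩
    show π.base x ∈ (U : Set Y)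
    rw [hx]; exact hy
  · intro h p hp k _ _ X f hs hl hq hi
    obtain ⟨X', π, hπ⟩ := h p hp k X f hs hl hq inferInstance
    haveI : IsReduced X' := hπ.isRegular.isReduced
    haveI : IsIntegral X' := hπ.isBirational.isIntegral
    obtain ⟨U, hU, -, hiso⟩ := hπ.isBirational
    exact ⟨X', π, hπ.isProper, inferInstance, hπ.isRegular,
      (hπ.isPurelyInseparableAlteration.surjective).1, U, hU, hiso⟩

end Summit.ResolutionOfSingularities.ResolutionOfSingularities.Theorems.Pialt.Negative

end
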